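import Summits.CriticalPhenomena.CardyFormulaZ2.Theorems.CardyFlipRussoVoronoiHubFromSmirnovOneArmEvents
import Literature.Analysis.FunctionSpaces.PointConfigFactorialMeasure
import Literature.Analysis.FunctionSpaces.PoissonPointProcessProofs
import Mathlib.Topology.Maps.Proper.Basic
import HarnessLib

/-!
# Stub `measurableSet_potDef` of line `moebius-exact-delaunay-dilation-ward`
# (crux `VoronoiHubFromSmirnov`, stmt-CriticalPhenomena-6433, route `CardyFlipRusso`)

**The potential-defect events are measurable.** In the one-arm route the probabilities of events
localised on disjoint regions multiply (landed `lawBW_iInter_restrict_eq_prod`), which needs the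
local events to be measurable for the product of the count σ-algebras. The two potential-defect
events of module `…OneArmEvents` — a near-tied navel `NearTie` and a close pair `ClosePair`
(I. Benjamini, O. Schramm, Comm. Math. Phys. 197 (1998), Lemma 4.2) — of the IMAGES
`T '' ((c.1 ∪ c.2) ∩ D)` of the windowed nuclei under a measurable map `T` injective on the
measurable window `D` are measurable events of the two-colour configuration `c`.

Proof.
* The windowed union `ω(c) = (c.1 ∪ c.2)|_D` depends measurably on `c` (superposition
  `PointConfig.measurable_union_holds`, restriction `PointConfig.measurable_restrict`).
* (`mpd_measurableSet_exists_mem_tuples`) For a measurable family of configurations `ω a` and a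
  measurable set `A` of `k`-tuples, `{a | some k-tuple of DISTINCT points of ω a lies in A}` is
  measurable: it is the non-vanishing set of `a ↦ (ω a)^{(k)}(A)`, the `k`-th factorial measure
  (`PointConfig.factorialMeasure`, measurable in the configuration by the tree's
  `PointConfig.measurable_factorialMeasure`; Last–Penrose 2017, Prop. 4.3) evaluated at `A`.
* Since `T` is injective on `D ⊇ ω(c)`, "four nuclei with pairwise distinct images" is "an
  injective 4-tuple of nuclei", so `NearTie` is the event of the previous item for the set `A` of
  4-tuples `v` whose images `(T (v i))ᵢ` satisfy the metric near-tie constraint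
  `∃ x ∈ closedBall z ρ, |v₀ x| = |v₁ x| ≤ ℓ, |v₂ x| = |v₃ x| ∈ [|v₀ x|, |v₀ x| + τ)`; similarly
  `ClosePair` with 2-tuples and the constraint `T v₀ ∈ closedBall z ρ, dist (T v₀) (T v₁) < τ`.
* (`mpd_measurableSet_nearTieTuples`) The near-tie constraint is a Borel set of 4-tuples: writing
  the one strict inequality as a countable union of closed ones, it is a countable union of sets
  `{w | ∃ x ∈ closedBall z ρ, C_n(w, x)}` with `C_n` closed, and these are closed because the
  projection along the COMPACT factor `closedBall z ρ` is a closed map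
  (`isClosedMap_fst_of_compactSpace`; `mpd_isClosed_exists_mem_of_isCompact`).

No new definitions; tree facts and Mathlib only.

Sources: G. Last, M. Penrose, *Lectures on the Poisson Process* (CUP 2017), §4.2 (4.4)–(4.5),
Prop. 4.3 (factorial measures are measurable in the configuration); I. Benjamini, O. Schramm,
Comm. Math. Phys. 197 (1998) §4, Lemma 4.2 (the potential defects).
-/

noncomputable section

namespace Summit.CriticalPhenomena.CardyFormulaZ2.Cruxes.VoronoiHubFromSmirnov.MoebiusExactDelaunayDilationWard

open scoped ENNReal
open Set MeasureTheory Metric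
open Literature.Analysis.FunctionSpaces

/-! ### Events "some tuple of distinct nuclei lies in a measurable set of tuples" -/

/-- For a measurable family of configurations `ω a` of `ℂ` and a measurable set `A` of `k`-tuples,
the set of parameters `a` for which some `k`-tuple of DISTINCT points of `ω a` lies in `A` is
measurable: it is the non-vanishing set of the factorial measure `(ω a)^{(k)}(A)`
(`PointConfig.factorialMeasure_apply`), and `a ↦ (ω a)^{(k)}` is measurable
(`PointConfig.measurable_factorialMeasure`, Last–Penrose 2017 Prop. 4.3). [folklore] -/
theorem mpd_measurableSet_exists_mem_tuples {α : Type*} [MeasurableSpace α]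
    {ω : α → PointConfig ℂ} (hω : Measurable ω) (k : ℕ) {A : Set (Fin k → ℂ)}
    (hA : MeasurableSet A) :
    MeasurableSet {a | ∃ v ∈ PointConfig.tuples k (ω a), v ∈ A} := by
  have hm : Measurable fun a => PointConfig.factorialMeasure k (ω a) A :=
    (Measure.measurable_coe hA).comp ((PointConfig.measurable_factorialMeasure k).comp hω)
  have h : {a | ∃ v ∈ PointConfig.tuples k (ω a), v ∈ A} =
      (fun a => PointConfig.factorialMeasure k (ω a) A) ⁻¹' ({0} : Set ℝ≥0∞)ᶜ := by
    ext a
    rw [mem_preimage, mem_compl_iff, mem_singleton_iff, PointConfig.factorialMeasure_apply k _ hA,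
      mem_setOf_eq, ENat.toENNReal_eq_zero, ← ne_eq, Set.encard_ne_zero]
    constructor
    · rintro ⟨v, hv, hvA⟩
      exact ⟨v, hvA, hv⟩
    · rintro ⟨v, hvA, hv⟩
      exact ⟨v, hv, hvA⟩
  rw [h]
  exact hm (measurableSet_singleton 0).compl

/-! ### Projections along a compact factor are closed; the near-tie constraint is Borel -/

/-- **Projection along a compact factor preserves closedness**: for compact `K ⊆ Y` and a closed
relation `P ⊆ X × Y`, the set `{x | ∃ y ∈ K, P x y}` is closed (`Prod.fst : X × K → X` is a closed
map, Mathlib's `isClosedMap_fst_of_compactSpace`). [folklore] -/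
theorem mpd_isClosed_exists_mem_of_isCompact {X Y : Type*} [TopologicalSpace X]
    [TopologicalSpace Y] {K : Set Y} (hK : IsCompact K) {P : X → Y → Prop}
    (hP : IsClosed {p : X × Y | P p.1 p.2}) : IsClosed {x | ∃ y ∈ K, P x y} := by
  haveI : CompactSpace K := isCompact_iff_compactSpace.1 hK
  have hc : Continuous fun p : X × K => (p.1, (p.2 : Y)) :=
    continuous_fst.prodMk (continuous_subtype_val.comp continuous_snd)
  have h : {x | ∃ y ∈ K, P x y} = Prod.fst '' {p : X × K | P p.1 (p.2 : Y)} := by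
    ext x
    constructor
    · rintro ⟨y, hy, hxy⟩
      exact ⟨(x, ⟨y, hy⟩), hxy, rfl⟩
    · rintro ⟨⟨x', y⟩, hxy, rfl⟩
      exact ⟨y, y.2, hxy⟩
  rw [h]
  exact isClosedMap_fst_of_compactSpace _ (hP.preimage hc)

/-- **The metric near-tie constraint is a Borel set of 4-tuples**: the set of `w : Fin 4 → ℂ`
admitting a point `x` with `dist x z ≤ ρ`, `dist (w 0) x = dist (w 1) x ≤ ℓ`,
`dist (w 2) x = dist (w 3) x`, `dist (w 0) x ≤ dist (w 2) x < dist (w 0) x + τ` is measurable —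
the strict inequality is a countable union of closed ones, and each resulting set is the
projection of a closed set along the compact factor `closedBall z ρ`
(`mpd_isClosed_exists_mem_of_isCompact`). [folklore] -/
theorem mpd_measurableSet_nearTieTuples (z : ℂ) (ρ ℓ τ : ℝ) :
    MeasurableSet {w : Fin 4 → ℂ | ∃ x ∈ closedBall z ρ, dist (w 0) x = dist (w 1) x ∧
      dist (w 0) x ≤ ℓ ∧ dist (w 2) x = dist (w 3) x ∧ dist (w 0) x ≤ dist (w 2) x ∧
      dist (w 2) x < dist (w 0) x + τ} := by
  have hc : ∀ i : Fin 4, Continuous fun p : (Fin 4 → ℂ) × ℂ => dist (p.1 i) p.2 := fun i =>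
    ((continuous_apply i).comp continuous_fst).dist continuous_snd
  have hclosed : ∀ n : ℕ, IsClosed {w : Fin 4 → ℂ | ∃ x ∈ closedBall z ρ,
      dist (w 0) x = dist (w 1) x ∧ dist (w 0) x ≤ ℓ ∧ dist (w 2) x = dist (w 3) x ∧
      dist (w 0) x ≤ dist (w 2) x ∧ dist (w 2) x + 1 / ((n : ℝ) + 1) ≤ dist (w 0) x + τ} := by
    intro n
    refine mpd_isClosed_exists_mem_of_isCompact (isCompact_closedBall z ρ)
      (P := fun (w : Fin 4 → ℂ) (x : ℂ) => dist (w 0) x = dist (w 1) x ∧ dist (w 0) x ≤ ℓ ∧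
        dist (w 2) x = dist (w 3) x ∧ dist (w 0) x ≤ dist (w 2) x ∧
        dist (w 2) x + 1 / ((n : ℝ) + 1) ≤ dist (w 0) x + τ) ?_
    simp only [setOf_and]
    exact (isClosed_eq (hc 0) (hc 1)).inter ((isClosed_le (hc 0) continuous_const).inter
      ((isClosed_eq (hc 2) (hc 3)).inter ((isClosed_le (hc 0) (hc 2)).inter
        (isClosed_le ((hc 2).add continuous_const) ((hc 0).add continuous_const)))))
  have heq : {w : Fin 4 → ℂ | ∃ x ∈ closedBall z ρ, dist (w 0) x = dist (w 1) x ∧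
      dist (w 0) x ≤ ℓ ∧ dist (w 2) x = dist (w 3) x ∧ dist (w 0) x ≤ dist (w 2) x ∧
      dist (w 2) x < dist (w 0) x + τ} = ⋃ n : ℕ, {w : Fin 4 → ℂ | ∃ x ∈ closedBall z ρ,
      dist (w 0) x = dist (w 1) x ∧ dist (w 0) x ≤ ℓ ∧ dist (w 2) x = dist (w 3) x ∧
      dist (w 0) x ≤ dist (w 2) x ∧ dist (w 2) x + 1 / ((n : ℝ) + 1) ≤ dist (w 0) x + τ} := by
    ext w
    simp only [mem_setOf_eq, mem_iUnion]
    constructor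
    · rintro ⟨x, hx, h1, h2, h3, h4, h5⟩
      obtain ⟨n, hn⟩ := exists_nat_one_div_lt (sub_pos.2 h5)
      exact ⟨n, x, hx, h1, h2, h3, h4, by linarith⟩
    · rintro ⟨n, x, hx, h1, h2, h3, h4, h5⟩
      have hpos : (0 : ℝ) < 1 / ((n : ℝ) + 1) := Nat.one_div_pos_of_nat
      exact ⟨x, hx, h1, h2, h3, h4, by linarith⟩
  rw [heq]
  exact MeasurableSet.iUnion fun n => (hclosed n).measurableSet

/-! ### The registered stub -/

/-- **The potential-defect events are measurable** (registered stub `measurableSet_potDef` of line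
`moebius-exact-delaunay-dilation-ward`): for a measurable window `D`, a measurable map `T`
injective on `D`, a centre `z` and parameters `ρ, ℓ, τ`, the near-tied-navel event `NearTie` and the
close-pair event `ClosePair` of the images `T '' ((c.1 ∪ c.2) ∩ D)` of the windowed nuclei are
measurable sets of two-colour configurations `c` — by injectivity of `T` on `D` both are events
"some tuple of distinct nuclei of the measurable windowed union `(c.1 ∪ c.2)|_D` lies in a Borel
set of tuples" (`mpd_measurableSet_exists_mem_tuples`, `mpd_measurableSet_nearTieTuples`).
[folklore] -/
theorem measurableSet_potDef : ∀ (D : Set ℂ) (T : ℂ → ℂ) (z : ℂ) (ρ ℓ τ : ℝ), MeasurableSet D → Measurable T → Set.InjOn T D → MeasurableSet {c : Literature.Analysis.FunctionSpaces.PointConfig ℂ × Literature.Analysis.FunctionSpaces.PointConfig ℂ | NearTie (T '' ((((c.1 : Set ℂ) ∪ (c.2 : Set ℂ)) ∩ D))) z ρ ℓ τ} ∧ MeasurableSet {c : Literature.Analysis.FunctionSpaces.PointConfig ℂ × Literature.Analysis.FunctionSpaces.PointConfig ℂ | ClosePair (T '' ((((c.1 : Set ℂ) ∪ (c.2 : Set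 ℂ)) ∩ D))) z ρ τ} := by
  intro D T z ρ ℓ τ hD hT hTD
  -- tuples with pairwise distinct entries are injective
  have hinj2 : ∀ {a b : ℂ}, a ≠ b → Function.Injective ![a, b] := by
    intro a b hab i j h
    fin_cases i <;> fin_cases j <;> simp_all
  have hinj4 : ∀ {a b c d : ℂ}, a ≠ b → a ≠ c → a ≠ d → b ≠ c → b ≠ d → c ≠ d →
      Function.Injective ![a, b, c, d] := by
    intro a b c d hab hac had hbc hbd hcd i j h
    fin_cases i <;> fin_cases j <;> simp_all
  -- the windowed union `(c.1 ∪ c.2)|_D` is a measurable function of `c`, with the right carrier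
  have hU : Measurable fun c : PointConfig ℂ × PointConfig ℂ => c.1 ∪ c.2 :=
    PointConfig.measurable_union_holds (E := ℂ)
  have hω : Measurable fun c : PointConfig ℂ × PointConfig ℂ => PointConfig.restrict D (c.1 ∪ c.2) :=
    (PointConfig.measurable_restrict hD).comp hU
  have hmem : ∀ (c : PointConfig ℂ × PointConfig ℂ) (y : ℂ),
      y ∈ PointConfig.restrict D (c.1 ∪ c.2) ↔ y ∈ ((c.1 : Set ℂ) ∪ (c.2 : Set ℂ)) ∩ D :=
    fun _ _ => Iff.rfl
  -- images of distinct windowed nuclei are distinct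
  have hne : ∀ (c : PointConfig ℂ × PointConfig ℂ) {k : ℕ} {v : Fin k → ℂ},
      v ∈ PointConfig.tuples k (PointConfig.restrict D (c.1 ∪ c.2)) →
      ∀ i j, i ≠ j → T (v i) ≠ T (v j) := fun c k v hv i j hij h =>
    hij (hv.1 (hTD ((hmem c _).1 (hv.2 i)).2 ((hmem c _).1 (hv.2 j)).2 h))
  have hN : ∀ (c : PointConfig ℂ × PointConfig ℂ) {k : ℕ} {v : Fin k → ℂ},
      v ∈ PointConfig.tuples k (PointConfig.restrict D (c.1 ∪ c.2)) →
      ∀ i, T (v i) ∈ T '' (((c.1 : Set ℂ) ∪ (c.2 : Set ℂ)) ∩ D) := fun c k v hv i =>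
    mem_image_of_mem T ((hmem c _).1 (hv.2 i))
  constructor
  · -- the near-tied navel
    have hΦ : Measurable fun (v : Fin 4 → ℂ) (i : Fin 4) => T (v i) :=
      measurable_pi_lambda _ fun i => hT.comp (measurable_pi_apply i)
    have hAm : MeasurableSet {v : Fin 4 → ℂ | ∃ x ∈ closedBall z ρ,
        dist (T (v 0)) x = dist (T (v 1)) x ∧ dist (T (v 0)) x ≤ ℓ ∧
        dist (T (v 2)) x = dist (T (v 3)) x ∧ dist (T (v 0)) x ≤ dist (T (v 2)) x ∧
        dist (T (v 2)) x < dist (T (v 0)) x + τ} :=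
      (mpd_measurableSet_nearTieTuples z ρ ℓ τ).preimage hΦ
    have heq : {c : PointConfig ℂ × PointConfig ℂ |
        NearTie (T '' ((((c.1 : Set ℂ) ∪ (c.2 : Set ℂ)) ∩ D))) z ρ ℓ τ} =
        {c | ∃ v ∈ PointConfig.tuples 4 (PointConfig.restrict D (c.1 ∪ c.2)),
          v ∈ {v : Fin 4 → ℂ | ∃ x ∈ closedBall z ρ,
            dist (T (v 0)) x = dist (T (v 1)) x ∧ dist (T (v 0)) x ≤ ℓ ∧
            dist (T (v 2)) x = dist (T (v 3)) x ∧ dist (T (v 0)) x ≤ dist (T (v 2)) x ∧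
            dist (T (v 2)) x < dist (T (v 0)) x + τ}} := by
      ext c
      constructor
      · rintro ⟨x, p, q, a, b, ⟨p', hp', rfl⟩, ⟨q', hq', rfl⟩, ⟨a', ha', rfl⟩, ⟨b', hb', rfl⟩,
          hpq, hab, hap, haq, hbp, hbq, hx, h1, h2, h3, h4, h5⟩
        refine ⟨![p', q', a', b'], ⟨?_, ?_⟩, ?_⟩
        · exact hinj4 (fun h => hpq (congrArg T h))
            (fun h => hap (congrArg T h).symm) (fun h => hbp (congrArg T h).symm)
            (fun h => haq (congrArg T h).symm) (fun h => hbq (congrArg T h).symm)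
            (fun h => hab (congrArg T h))
        · intro i
          fin_cases i
          · exact hp'
          · exact hq'
          · exact ha'
          · exact hb'
        · exact ⟨x, hx, h1, h2, h3, h4, h5⟩
      · rintro ⟨v, hv, x, hx, h1, h2, h3, h4, h5⟩
        exact ⟨x, T (v 0), T (v 1), T (v 2), T (v 3), hN c hv 0, hN c hv 1, hN c hv 2, hN c hv 3,
          hne c hv 0 1 (by decide), hne c hv 2 3 (by decide), hne c hv 2 0 (by decide),
          hne c hv 2 1 (by decide), hne c hv 3 0 (by decide), hne c hv 3 1 (by decide),
          hx, h1, h2, h3, h4, h5⟩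
    rw [heq]
    exact mpd_measurableSet_exists_mem_tuples hω 4 hAm
  · -- the close pair
    have h0 : Measurable fun v : Fin 2 → ℂ => T (v 0) := hT.comp (measurable_pi_apply 0)
    have h1 : Measurable fun v : Fin 2 → ℂ => T (v 1) := hT.comp (measurable_pi_apply 1)
    have hAm : MeasurableSet {v : Fin 2 → ℂ | T (v 0) ∈ closedBall z ρ ∧
        dist (T (v 0)) (T (v 1)) < τ} := by
      rw [setOf_and]
      exact (h0 measurableSet_closedBall).inter (measurableSet_lt (h0.dist h1) measurable_const)
    have heq : {c : PointConfig ℂ × PointConfig ℂ |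
        ClosePair (T '' ((((c.1 : Set ℂ) ∪ (c.2 : Set ℂ)) ∩ D))) z ρ τ} =
        {c | ∃ v ∈ PointConfig.tuples 2 (PointConfig.restrict D (c.1 ∪ c.2)),
          v ∈ {v : Fin 2 → ℂ | T (v 0) ∈ closedBall z ρ ∧ dist (T (v 0)) (T (v 1)) < τ}} := by
      ext c
      constructor
      · rintro ⟨a, ⟨a', ha', rfl⟩, b, ⟨b', hb', rfl⟩, hab, haz, hd⟩
        refine ⟨![a', b'], ⟨hinj2 fun h => hab (congrArg T h), ?_⟩, haz, hd⟩
        intro i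
        fin_cases i
        · exact ha'
        · exact hb'
      · rintro ⟨v, hv, haz, hd⟩
        exact ⟨T (v 0), hN c hv 0, T (v 1), hN c hv 1, hne c hv 0 1 (by decide), haz, hd⟩
    rw [heq]
    exact mpd_measurableSet_exists_mem_tuples hω 2 hAm

end Summit.CriticalPhenomena.CardyFormulaZ2.Cruxes.VoronoiHubFromSmirnov.MoebiusExactDelaunayDilationWard

end
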